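import Summits.QuantumFields.YangMills.Theorems.UnitScaleTiltFluctuationComparisonRegPrTwoCutoffOperatorHeightFree
import HarnessLib

/-!
# `UnitScaleTiltFluctuationComparisonRegPrTwoCutoffCovarianceHeightFree` — THE HEIGHT-FREE REFERENCE COVARIANCE: on every unit torus King's unit-lattice fluctuation
# covariances `C^{(k)} = (Δ^{(k)} + aL⁻²Q*Q)⁻¹` CONVERGE (`k → ∞`) to ONE symmetric kernel `C^{(∞)}`, with `|C^{(k)}(x,y) − C^{(∞)}(x,y)| ≤ K₄₅·L^{−k}·e^{−δ₄₅·dist(x,y)}`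
# for every `k ≥ 1` — [King1986] Lemma 4.5 in REFERENCE form, hypothesis-free
# (crux `FluctuationComparisonRegPrIntL`, stmt-QuantumFields-20520, STUB 3⁗χ; cell `pub/ym-inputs`, INPUT-LIST I-11 row p10 «K-uniform two-cut-off propagator estimate behind
# `FlatKernelLegCauchyΦ`»; seat ym-inputs-p10, file 3, count-neutral helper, def-free)

WHY.  The propagator on the lines of [King1986]'s graphs `E^{(k)}(H)` (whose flat kernels (3.55) are the template of the K1a row `FlatKernelLegCauchyΦ` ∕ (R1) `KernelRefOwnΦ`) is the
unit-lattice fluctuation covariance `C^{(k)}` of (2.16); its two-run rate is Lemma 4.5 (4.38) «`|C^{(k)}(x, y) − C^{(k+n)}(x, y)| ≤ CL^{−k}e^{−δ₀|x−y|}`», which the tree PROVES for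
King's actual operators on every torus `Π_μ ℤ∕(LM_μ)` (`King1986.Torus.king_lemma45_torus`, cell pub-balaban, hypothesis-free, constants `K45 d a L`, `delta45 d a L`).  Files 1–2 of
this seat (`…TwoCutoffSymbolHeightFree` ✓ p618709, `…TwoCutoffOperatorHeightFree` ✓ p619483) put the effective Laplacian `Δ^{(k)}` into the PER-RUN REFERENCE FORM of the K1a
architecture (each level within `O(L^{−2k})` of ONE height-free object).  This file does the same for the covariance — the object that actually decorates graph lines:

* §1 `effLaplacian_congrN` (the level index of `effLaplacian` may be rewritten along an equality of naturals — `NeZero` is a `Prop`), `blockProj_symm`, `covariance_symm`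
  (`C^{(k)}` is a symmetric kernel), **`covariance_twoRun_apply_le`** (the tree's `king_lemma45_torus` re-indexed from `L^n·L^k` to `L^{k+n}` so that `k ↦ C^{(k)}` is ONE sequence);
* §2 **`exists_heightFree_covariance`**: for `a > 0`, `m² > 0`, `L ≥ 2` and every torus `Π ℤ∕(LM_μ)` there is ONE symmetric matrix `C^{(∞)}` with `C^{(k)}(x,y) → C^{(∞)}(x,y)`,
  `|C^{(k)}(x,y) − C^{(∞)}(x,y)| ≤ K₄₅·L^{−k}·e^{−δ₄₅·tdist(x,y)}` for EVERY `k ≥ 1` and all `x, y` (the decay of the DIFFERENCE survives the limit), and `⟨φ, C^{(k)}ψ⟩ → ⟨φ, C^{(∞)}ψ⟩`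
  — by file 2's analysis lemma `exists_limit_of_uniform_cauchy` with `b_k = K₄₅L^{−k}e^{−δ₄₅t}`, `r = L⁻¹`; `heightFree_covariance_unique` (the reference is determined).

HONEST FRAMING.  Flat, abelian, `A = 0`, periodic boundary conditions, `m² > 0` (the setting of the tree's `King1986/*`); a limit theorem assembled from PROVED tree lemmas; it is NOT the
non-abelian `d = 3` two-cut-off statement for Bałaban's `G_k(Ω; U₀)` (no carrier in the tree, unprinted — INPUT-LIST I-11, KILL-TEST E2 = NO), touches neither the stub, the crux nor
the (α) record, and asserts nothing of [Balaban1985UV3] ∕ [King1986].  YM₃ on T³ is a ladder rung, not the Clay problem ∕ 𝕋⁴ ∕ a mass gap; no summit or sub-problem statement here.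

References: C. King, CMP 102 (1986) 649–677 [King1986] ((2.16) p.653, (3.55) p.662, Prop. 3.6 (3.56) p.662, Lemma 4.5 (4.38) p.674, (4.39)–(4.41) pp.674–675; p.657 «is a Cauchy
sequence and converges to a unique limit»).
-/

set_option autoImplicit false

noncomputable section

open Filter Topology Real Finset Matrix
open scoped BigOperators
open Literature.MathematicalPhysics.QuantumFieldTheory.Balaban1983to89
open Literature.MathematicalPhysics.QuantumFieldTheory.Balaban1983to89.B5Prop11Plancherel
open Literature.MathematicalPhysics.QuantumFieldTheory.King1986
open Literature.MathematicalPhysics.QuantumFieldTheory.King1986.Torus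
open Summit.QuantumFields.YangMills.Theorems.TwoCutoffOperatorHeightFree (exists_limit_of_uniform_cauchy limit_unique tendsto_dotProduct_mulVec)

namespace Summit.QuantumFields.YangMills.Theorems.TwoCutoffCovarianceHeightFree

variable {d : ℕ}

/-! ## §1 Re-indexing, symmetry, and the two-run covariance rate as one sequence -/

/-- **The level index of `effLaplacian` rewrites along an equality of naturals** (`NeZero N` is a proposition, so the two instances agree). [folklore] -/
theorem effLaplacian_congrN {N N' : ℕ} [NeZero N] [NeZero N'] (h : N = N') (M : Fin d → ℕ) [∀ μ, NeZero (M μ)] (a c m2 : ℝ) :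
    effLaplacian N M a c m2 = effLaplacian N' M a c m2 := by
  subst h
  rfl

/-- `Q*Q` is a symmetric kernel. [cite: King1986, (4.36) p.674] -/
theorem blockProj_symm (L : ℕ) [NeZero L] (M : Fin d → ℕ) [∀ μ, NeZero (M μ)] (y y' : Tor (fine L M)) :
    blockProj L M y' y = blockProj L M y y' := by
  unfold blockProj
  by_cases h : blockOf L M y = blockOf L M y'
  · rw [if_pos h, if_pos h.symm]
  · rw [if_neg h, if_neg fun h' => h h'.symm]

/-- **`C^{(k)} = (Δ^{(k)} + aL⁻²Q*Q)⁻¹` is a symmetric kernel** (`Δ^{(k)}` and `Q*Q` are; `(A⁻¹)ᵀ = (Aᵀ)⁻¹`). [cite: King1986, (2.16) p.653, (4.32) p.674] -/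
theorem covariance_symm (N L : ℕ) [NeZero N] [NeZero L] (M : Fin d → ℕ) [∀ μ, NeZero (M μ)] (a₁ c m2 s : ℝ) (x y : Tor (fine L M)) :
    (effLaplacian N (fine L M) a₁ c m2 + s • blockProj L M)⁻¹ y x = (effLaplacian N (fine L M) a₁ c m2 + s • blockProj L M)⁻¹ x y := by
  set A : Matrix (Tor (fine L M)) (Tor (fine L M)) ℝ := effLaplacian N (fine L M) a₁ c m2 + s • blockProj L M with hA
  have hT : Aᵀ = A := by
    ext i j
    simp only [hA, Matrix.transpose_apply, Matrix.add_apply, Matrix.smul_apply, effLaplacian_symm N (fine L M) a₁ c m2 j i, blockProj_symm L M j i]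
  calc A⁻¹ y x = (A⁻¹)ᵀ x y := rfl
    _ = (Aᵀ)⁻¹ x y := by rw [Matrix.transpose_nonsing_inv]
    _ = A⁻¹ x y := by rw [hT]

/-- **LEMMA 4.5 ON THE TORUS AS ONE SEQUENCE IN `k`**: for `L ≥ 2`, `k, n ≥ 1`, `a > 0`, `m² > 0`, every torus `Π ℤ∕(LM_μ)` and all `x, y`,
`|C^{(k)}(x,y) − C^{(k+n)}(x,y)| ≤ K₄₅·L^{−k}·e^{−δ₄₅·tdist(x,y)}` with `C^{(j)} = (effLaplacian (L^j) (fine L M) a_j L^{2j} m² + aL⁻²·Q*Q)⁻¹` — the tree's `king_lemma45_torus`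
(stated with the fine index `L^n·L^k`) re-indexed to `L^{k+n}`. [cite: King1986, Lemma 4.5 (4.38) p.674] -/
theorem covariance_twoRun_apply_le {a m2 : ℝ} (ha : 0 < a) (hm : 0 < m2) {L k n : ℕ} [NeZero L] (hL : 2 ≤ L) (hk : 1 ≤ k) (hn : 1 ≤ n)
    (M : Fin d → ℕ) [∀ μ, NeZero (M μ)] (x y : Tor (fine L M)) :
    |(effLaplacian (L ^ k) (fine L M) (aK a L k) (((L ^ k : ℕ) : ℝ) ^ 2) m2 + (a * ((L : ℝ) ^ 2)⁻¹) • blockProj L M)⁻¹ x y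
        - (effLaplacian (L ^ (k + n)) (fine L M) (aK a L (k + n)) (((L ^ (k + n) : ℕ) : ℝ) ^ 2) m2 + (a * ((L : ℝ) ^ 2)⁻¹) • blockProj L M)⁻¹ x y|
      ≤ K45 d a L * ((L : ℝ) ^ k)⁻¹ * Real.exp (-(delta45 d a L * tdistT (fine L M) x y)) := by
  have h := king_lemma45_torus ha hm hL hk hn M x y
  have hnat : L ^ n * L ^ k = L ^ (k + n) := by rw [pow_add, mul_comm]
  have e : effLaplacian (L ^ n * L ^ k) (fine L M) (aK a L (k + n)) (((L ^ n * L ^ k : ℕ) : ℝ) ^ 2) m2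
      = effLaplacian (L ^ (k + n)) (fine L M) (aK a L (k + n)) (((L ^ (k + n) : ℕ) : ℝ) ^ 2) m2 := by
    rw [effLaplacian_congrN hnat]
    rw [hnat]
  rw [e] at h
  exact h

/-! ## §2 The height-free reference covariance -/

/-- **THE HEIGHT-FREE REFERENCE COVARIANCE — hypothesis-free, on every unit torus `Π ℤ∕(LM_μ)`.**  For `a > 0`, `m² > 0`, `L ≥ 2` there is ONE real matrix `C^{(∞)}` such that,
with `C^{(k)} = (effLaplacian (L^k) (fine L M) a_k L^{2k} m² + aL⁻²·Q*Q)⁻¹` King's level-`k` fluctuation covariance: (i) `C^{(∞)}` is symmetric; (ii) `C^{(k)}(x,y) → C^{(∞)}(x,y)`;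
(iii) `|C^{(k)}(x,y) − C^{(∞)}(x,y)| ≤ K₄₅·L^{−k}·e^{−δ₄₅·tdist(x,y)}` for EVERY `k ≥ 1` and all `x, y` (the exponential decay of the two-run difference survives the limit);
(iv) `⟨φ, C^{(k)}ψ⟩ → ⟨φ, C^{(∞)}ψ⟩` for all `φ, ψ` — each level's covariance is within `O(L^{−k})` of a SINGLE run-independent kernel: Lemma 4.5 read in the REFERENCE FORM of the
K1a display row (R1) (`KernelRefOwnΦ` against a height-free `Ψ`), for the propagator on the graph lines of (3.55). [cite: King1986, Lemma 4.5 (4.38) p.674; Prop. 3.6 (3.56) p.662 with (3.58)-(3.61) p.663] -/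
theorem exists_heightFree_covariance {a m2 : ℝ} (ha : 0 < a) (hm : 0 < m2) {L : ℕ} [NeZero L] (hL : 2 ≤ L) (M : Fin d → ℕ) [∀ μ, NeZero (M μ)] :
    ∃ Cinf : Matrix (Tor (fine L M)) (Tor (fine L M)) ℝ,
      (∀ x y, Cinf y x = Cinf x y) ∧
      (∀ x y, Tendsto (fun k : ℕ =>
          (effLaplacian (L ^ k) (fine L M) (aK a L k) (((L ^ k : ℕ) : ℝ) ^ 2) m2 + (a * ((L : ℝ) ^ 2)⁻¹) • blockProj L M)⁻¹ x y) atTop (𝓝 (Cinf x y))) ∧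
      (∀ k : ℕ, 1 ≤ k → ∀ x y,
        |(effLaplacian (L ^ k) (fine L M) (aK a L k) (((L ^ k : ℕ) : ℝ) ^ 2) m2 + (a * ((L : ℝ) ^ 2)⁻¹) • blockProj L M)⁻¹ x y - Cinf x y|
          ≤ K45 d a L * ((L : ℝ) ^ k)⁻¹ * Real.exp (-(delta45 d a L * tdistT (fine L M) x y))) ∧
      (∀ φ ψ : Tor (fine L M) → ℝ, Tendsto (fun k : ℕ =>
          φ ⬝ᵥ ((effLaplacian (L ^ k) (fine L M) (aK a L k) (((L ^ k : ℕ) : ℝ) ^ 2) m2 + (a * ((L : ℝ) ^ 2)⁻¹) • blockProj L M)⁻¹ *ᵥ ψ)) atTop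
        (𝓝 (φ ⬝ᵥ (Cinf *ᵥ ψ)))) := by
  have hL1 : (1 : ℝ) < L := by exact_mod_cast hL
  have hr1 : ((L : ℝ))⁻¹ < 1 := inv_lt_one_of_one_lt₀ hL1
  have hpw : ∀ k : ℕ, ((L : ℝ) ^ k)⁻¹ = ((L : ℝ)⁻¹) ^ k := fun k => by rw [inv_pow]
  have hentry : ∀ x y : Tor (fine L M), ∃ c : ℝ,
      Tendsto (fun k : ℕ => (effLaplacian (L ^ k) (fine L M) (aK a L k) (((L ^ k : ℕ) : ℝ) ^ 2) m2 + (a * ((L : ℝ) ^ 2)⁻¹) • blockProj L M)⁻¹ x y) atTop (𝓝 c) ∧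
      ∀ k : ℕ, 1 ≤ k → |(effLaplacian (L ^ k) (fine L M) (aK a L k) (((L ^ k : ℕ) : ℝ) ^ 2) m2 + (a * ((L : ℝ) ^ 2)⁻¹) • blockProj L M)⁻¹ x y - c|
          ≤ K45 d a L * ((L : ℝ) ^ k)⁻¹ * Real.exp (-(delta45 d a L * tdistT (fine L M) x y)) := by
    intro x y
    refine exists_limit_of_uniform_cauchy
      (s := fun k : ℕ => (effLaplacian (L ^ k) (fine L M) (aK a L k) (((L ^ k : ℕ) : ℝ) ^ 2) m2 + (a * ((L : ℝ) ^ 2)⁻¹) • blockProj L M)⁻¹ x y)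
      (b := fun k => K45 d a L * ((L : ℝ) ^ k)⁻¹ * Real.exp (-(delta45 d a L * tdistT (fine L M) x y)))
      (C := K45 d a L * Real.exp (-(delta45 d a L * tdistT (fine L M) x y))) (r := ((L : ℝ))⁻¹) hr1 (fun k _ => ?_)
      (fun k n hk hn => covariance_twoRun_apply_le ha hm hL hk hn M x y)
    rw [hpw k]
    exact le_of_eq (by ring)
  choose C hCt hCr using hentry
  refine ⟨fun x y => C x y, ?_, hCt, fun k hk x y => hCr x y k hk, ?_⟩
  · intro x y
    refine limit_unique (hCt y x) ?_
    refine (hCt x y).congr fun k => ?_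
    exact (covariance_symm (L ^ k) L M (aK a L k) (((L ^ k : ℕ) : ℝ) ^ 2) m2 (a * ((L : ℝ) ^ 2)⁻¹) x y).symm
  · intro φ ψ
    exact tendsto_dotProduct_mulVec
      (T := fun k : ℕ => (effLaplacian (L ^ k) (fine L M) (aK a L k) (((L ^ k : ℕ) : ℝ) ^ 2) m2 + (a * ((L : ℝ) ^ 2)⁻¹) • blockProj L M)⁻¹)
      (Tinf := fun x y => C x y) hCt φ ψ

/-- **THE REFERENCE COVARIANCE IS DETERMINED** (uniqueness of limits, entry by entry): any matrix towards which the `C^{(k)}` converge entrywise equals the one of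
`exists_heightFree_covariance`. [folklore] -/
theorem heightFree_covariance_unique {a m2 : ℝ} {L : ℕ} [NeZero L] (M : Fin d → ℕ) [∀ μ, NeZero (M μ)] {C₁ C₂ : Matrix (Tor (fine L M)) (Tor (fine L M)) ℝ}
    (h₁ : ∀ x y, Tendsto (fun k : ℕ =>
        (effLaplacian (L ^ k) (fine L M) (aK a L k) (((L ^ k : ℕ) : ℝ) ^ 2) m2 + (a * ((L : ℝ) ^ 2)⁻¹) • blockProj L M)⁻¹ x y) atTop (𝓝 (C₁ x y)))
    (h₂ : ∀ x y, Tendsto (fun k : ℕ =>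
        (effLaplacian (L ^ k) (fine L M) (aK a L k) (((L ^ k : ℕ) : ℝ) ^ 2) m2 + (a * ((L : ℝ) ^ 2)⁻¹) • blockProj L M)⁻¹ x y) atTop (𝓝 (C₂ x y))) :
    C₁ = C₂ := by
  ext x y
  exact limit_unique (h₁ x y) (h₂ x y)

/-- **THE PRINTED `∃ C, δ₀` SHAPE, REFERENCE FORM**: for `a > 0`, `L ≥ 2` there are `C ≥ 0`, `δ₀ > 0` such that for every mass `m² > 0` and every torus the levels `C^{(k)}` converge
entrywise to a kernel `C^{(∞)}` with `|C^{(k)}(x,y) − C^{(∞)}(x,y)| ≤ C·L^{−k}·e^{−δ₀·tdist(x,y)}` for all `k ≥ 1` (constants uniform in the mass and the torus, as in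
`king_lemma45_torus_exists`). [cite: King1986, Lemma 4.5 (4.38) p.674] -/
theorem exists_heightFree_covariance_consts {a : ℝ} (ha : 0 < a) {L : ℕ} [NeZero L] (hL : 2 ≤ L) :
    ∃ C δ₀ : ℝ, 0 ≤ C ∧ 0 < δ₀ ∧ ∀ (m2 : ℝ), 0 < m2 → ∀ (M : Fin d → ℕ) [∀ μ, NeZero (M μ)],
      ∃ Cinf : Matrix (Tor (fine L M)) (Tor (fine L M)) ℝ, ∀ x y,
        Tendsto (fun k : ℕ =>
          (effLaplacian (L ^ k) (fine L M) (aK a L k) (((L ^ k : ℕ) : ℝ) ^ 2) m2 + (a * ((L : ℝ) ^ 2)⁻¹) • blockProj L M)⁻¹ x y) atTop (𝓝 (Cinf x y)) ∧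
        ∀ k : ℕ, 1 ≤ k →
          |(effLaplacian (L ^ k) (fine L M) (aK a L k) (((L ^ k : ℕ) : ℝ) ^ 2) m2 + (a * ((L : ℝ) ^ 2)⁻¹) • blockProj L M)⁻¹ x y - Cinf x y|
            ≤ C * ((L : ℝ) ^ k)⁻¹ * Real.exp (-(δ₀ * tdistT (fine L M) x y)) := by
  refine ⟨K45 d a L, delta45 d a L, K45_nonneg a L, delta45_pos ha hL, fun m2 hm M _ => ?_⟩
  obtain ⟨Cinf, -, hCt, hCr, -⟩ := exists_heightFree_covariance ha hm hL M
  exact ⟨Cinf, fun x y => ⟨hCt x y, fun k hk => hCr k hk x y⟩⟩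

end Summit.QuantumFields.YangMills.Theorems.TwoCutoffCovarianceHeightFree

end
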